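import Summits.NavierStokesRegularity.NavierStokesRegularity.Theses.AxisymmetricExtremality
import Summits.NavierStokesRegularity.NavierStokesRegularity.Theorems.AxisymmetricExtremalityAxisymmetricKatoGlobalReduction
import Summits.NavierStokesRegularity.NavierStokesRegularity.Theorems.AxisymmetricExtremalityAxisymmetricKatoGlobalStubSereginLogSwirlOrigin
import Literature.Analysis.FluidPDE.AxisymmetricEuler
import Literature.Analysis.FluidPDE.KatoMaximalTime
import HarnessLib.Audit

/-!
# Strategist census `s20-g29` (independent family `s`) — TYPED ATTEMPTS for the crux
# `AxisymmetricExtremality.AxisymmetricKatoGlobal` (stmt-NavierStokesRegularity-15453)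

Companion of `STRATEGY-CENSUS-s20.md` (same crux directory).  Nothing here is a new line and
nothing is registered: these are the SIGNATURES the census discusses, kernel-checked so that the
census' "concrete attempt under each heading" is a Lean statement and not prose.

* §W  the strictly-weaker intermediate that `closes` actually consumes:
      `NoAxisymMinimalBlowupDatum` (W1), with `W1 ⇐ crux` and `closes` re-run from W1
      (both sorry-free) — so W1 is the EXACT residual of the route at this node.
* §T  the transfer of the sibling crux's radial-inflow cut (Q. S. Zhang, arXiv:2604.07785,
      Thm 1.1 "partial Type I") to the Kato class, typed as a split of the registered open stub
      `stub_swirlAxisModulus` into (A) `SwirlModulusOfPartialTypeI` (criterion) and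
      (B) `PartialTypeIAtAxis` (a-priori one-sided bound), with the sorry-free compositions
      `swirlAxisModulus_of_partialTypeI` and `crux_of_partialTypeI` (the latter through the LANDED
      `Registered.AxisymmetricKatoGlobal_of_logSwirlFacts` + `seregin2022_logSwirl_regularAtOrigin_holds`).
* §S  the strengthening `QuantitativeAxisymBound` (a-priori sup bound by a function of the data
      norm) with `crux ⇐ S⁺` NOT proved here (it needs the Kato continuation criterion; recorded as
      a statement only).

All `def`s are `Prop`s; the census explains why none of them is registered as a line.
-/

noncomputable section

open Set MeasureTheory Filter Topology Function Metric
open scoped ENNReal NNReal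
open Literature.Analysis.FluidPDE Literature.Analysis.FunctionSpaces
open Summit.NavierStokesRegularity.NavierStokesRegularity.Theses.AxisymmetricExtremality
open Summit.NavierStokesRegularity.NavierStokesRegularity.Theorems.AxisymmetricKatoGlobal

namespace Summit.NavierStokesRegularity.NavierStokesRegularity.Cruxes.AxisymmetricKatoGlobal.StrategistS20g29

local notation "ℝ³" => EuclideanSpace ℝ (Fin 3)

/-! ## §W — the weakest replacement of the crux that still feeds `closes` -/

/-- **W1.** No axisymmetric `Ḣ^{1/2}`-minimal blow-up datum (Rusin–Šverák minimal data,
`IsMinimalBlowupDatum`), axisymmetry written out exactly as in the crux. This is the only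
instance of `AxisymmetricKatoGlobal` that the route's deciding theorem `closes` consumes. -/
def NoAxisymMinimalBlowupDatum : Prop :=
  ∀ ν : ℝ, 0 < ν → ∀ (u₀ : ℝ³ → ℝ³) (g : HomSobolev ℝ³ (EuclideanSpace ℂ (Fin 3)) (1 / 2 : ℝ)),
    IsMinimalBlowupDatum ν u₀ g →
    (∀ (θ : ℝ) (x : ℝ³), u₀ (WithLp.toLp 2 ![Real.cos θ * x 0 - Real.sin θ * x 1,
        Real.sin θ * x 0 + Real.cos θ * x 1, x 2]) =
      WithLp.toLp 2 ![Real.cos θ * u₀ x 0 - Real.sin θ * u₀ x 1,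
        Real.sin θ * u₀ x 0 + Real.cos θ * u₀ x 1, u₀ x 2]) →
    False

/-- `crux ⇒ W1` (W1 is weaker): a minimal blow-up datum is in particular a critical axisymmetric
datum without a global Kato solution. [folklore] -/
theorem noAxisymMinimalBlowupDatum_of_crux (h : AxisymmetricKatoGlobal) :
    NoAxisymMinimalBlowupDatum := by
  intro ν hν u₀ g hmin hax
  obtain ⟨hL3, hrep, hdiv, -, hnot⟩ := hmin
  exact hnot (h ν hν u₀ g hL3 hrep hdiv hax)

/-- `closes` re-run with the crux replaced by W1 — the same three lines of logic, so W1 is the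
exact residual of the route at this node. [folklore] -/
theorem closes_of_noAxisymMinimalBlowupDatum (h₂ : MinimalDatumPFold) (h₄ : PFoldToAxisymmetric)
    (h₃ : NoAxisymMinimalBlowupDatum) :
    _root_.NavierStokesRegularity := by
  show Literature.NS.NavierStokesExistenceSmoothR3
  intro ν hν u₀ hsm hdiv hdec
  by_contra hno
  obtain ⟨u₁, g, hmin, hax⟩ := h₄ ν hν (h₂ ν hν ⟨u₀, hsm, hdiv, hdec, hno⟩)
  exact h₃ ν hν u₁ g hmin hax

/-! ## §T — transfer of the one-sided radial-inflow cut (Zhang 2026) to the Kato class,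
typed as a split of the registered open stub `stub_swirlAxisModulus` -/

/-- **(B) a-priori partial Type I at the axis.** Every axisymmetric Kato solution on `(0,T)`
satisfies, on `[t₀,T)` and in an axis tube `{cylRadius ≤ δ₀}`, the ONE-SIDED Type-I bound
`u_r ≥ -c/√(T-t)` on the radial velocity (inflow at most Type-I; outflow, swirl, axial velocity
free). Open; its negation is the signature of Hou's interior scenario (arXiv:2107.06509). -/
def PartialTypeIAtAxis : Prop :=
  ∀ ν : ℝ, 0 < ν → ∀ T : ℝ, 0 < T → ∀ (u₀ : ℝ³ → ℝ³)
    (g : HomSobolev ℝ³ (EuclideanSpace ℂ (Fin 3)) (1 / 2 : ℝ)) (u : ℝ → ℝ³ → ℝ³),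
    g.Represents (Literature.Analysis.FunctionSpaces.EuclideanSpace.complexify ∘ u₀) →
    IsKatoSolutionOn T ν u₀ u → ContDiffOn ℝ (⊤ : ℕ∞) (uncurry u) (Ioo 0 T ×ˢ univ) →
    (∀ t ∈ Ioo 0 T, IsAxisymmetric (u t)) →
    ∀ t₀ ∈ Ioo 0 T, ∃ c δ₀ : ℝ, 0 < δ₀ ∧
      ∀ t ∈ Ico t₀ T, ∀ x : ℝ³, cylRadius x ≤ δ₀ →
        -(c / Real.sqrt (T - t)) ≤ radialVelocity (u t) x

/-- **(A) partial Type I ⇒ log³ swirl modulus** (the Kato-class, axis-tube form of Q. S. Zhang,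
arXiv:2604.07785 Thm 1.1, whose proof constructs a modulus of continuity for `Γ = r u_θ` at the
axis from the one-sided bound; printed for Leray–Hopf solutions from `L² ∩ L^∞ ∩ C³` data with
`Γ₀ ∈ L^∞`, conclusion "bounded and smooth on `[0,T]`", hence any modulus). Not in print in this
local / critical-data form. -/
def SwirlModulusOfPartialTypeI : Prop :=
  ∀ ν : ℝ, 0 < ν → ∀ T : ℝ, 0 < T → ∀ (u₀ : ℝ³ → ℝ³)
    (g : HomSobolev ℝ³ (EuclideanSpace ℂ (Fin 3)) (1 / 2 : ℝ)) (u : ℝ → ℝ³ → ℝ³),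
    g.Represents (Literature.Analysis.FunctionSpaces.EuclideanSpace.complexify ∘ u₀) →
    IsKatoSolutionOn T ν u₀ u → ContDiffOn ℝ (⊤ : ℕ∞) (uncurry u) (Ioo 0 T ×ˢ univ) →
    (∀ t ∈ Ioo 0 T, IsAxisymmetric (u t)) →
    ∀ t₀ ∈ Ioo 0 T,
      (∃ c δ₀ : ℝ, 0 < δ₀ ∧ ∀ t ∈ Ico t₀ T, ∀ x : ℝ³, cylRadius x ≤ δ₀ →
          -(c / Real.sqrt (T - t)) ≤ radialVelocity (u t) x) →
      ∃ C δ₀ : ℝ, 0 < δ₀ ∧ δ₀ < 1 ∧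
        ∀ t ∈ Ico t₀ T, ∀ x : ℝ³, cylRadius x ≤ δ₀ →
          |swirl (u t) x| ≤ C / |Real.log (cylRadius x)| ^ 3

/-- The split composes to the registered open stub `stub_swirlAxisModulus` VERBATIM (statement of
`Lines/registered.lean` = `Lines/euler_scaling.lean`). [folklore] -/
theorem swirlAxisModulus_of_partialTypeI (hA : SwirlModulusOfPartialTypeI)
    (hB : PartialTypeIAtAxis) :
    ∀ ν : ℝ, 0 < ν → ∀ T : ℝ, 0 < T → ∀ (u₀ : ℝ³ → ℝ³)
      (g : HomSobolev ℝ³ (EuclideanSpace ℂ (Fin 3)) (1 / 2 : ℝ)) (u : ℝ → ℝ³ → ℝ³),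
      g.Represents (Literature.Analysis.FunctionSpaces.EuclideanSpace.complexify ∘ u₀) →
      IsKatoSolutionOn T ν u₀ u → ContDiffOn ℝ (⊤ : ℕ∞) (uncurry u) (Ioo 0 T ×ˢ univ) →
      (∀ t ∈ Ioo 0 T, IsAxisymmetric (u t)) →
      ∀ t₀ ∈ Ioo 0 T, ∃ C δ₀ : ℝ, 0 < δ₀ ∧ δ₀ < 1 ∧
        ∀ t ∈ Ico t₀ T, ∀ x : ℝ³, cylRadius x ≤ δ₀ →
          |swirl (u t) x| ≤ C / |Real.log (cylRadius x)| ^ 3 := by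
  intro ν hν T hT u₀ g u hrep hK hsm hax t₀ ht₀
  exact hA ν hν T hT u₀ g u hrep hK hsm hax t₀ ht₀ (hB ν hν T hT u₀ g u hrep hK hsm hax t₀ ht₀)

/-- … and hence to the crux BY NAME, through the landed capstone of line `registered`
(`Registered.AxisymmetricKatoGlobal_of_logSwirlFacts`, p150628) and the landed discharge of
Seregin 2022 §2 (`EulerScaling.seregin2022_logSwirl_regularAtOrigin_holds`). [folklore] -/
theorem crux_of_partialTypeI (hA : SwirlModulusOfPartialTypeI) (hB : PartialTypeIAtAxis) :
    AxisymmetricKatoGlobal :=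
  Registered.AxisymmetricKatoGlobal_of_logSwirlFacts
    EulerScaling.seregin2022_logSwirl_regularAtOrigin_holds
    (swirlAxisModulus_of_partialTypeI hA hB)

/-! ## §S — the strengthening recorded by the census (statement only) -/

/-- **S⁺ (quantitative axisymmetric regularity).** An a-priori sup bound for axisymmetric Kato
solutions by a function of the critical datum norm, `ν` and `t` alone. Implies the crux through
the Kato continuation criterion (`IsKatoSolutionOn.continuation_of_bounded`, not composed here)
and would also bridge the Schwartz-data / critical-data gap of §W of the census; no tool. -/
def QuantitativeAxisymBound : Prop :=
  ∃ F : ℝ → ℝ → ℝ → ℝ, ∀ ν : ℝ, 0 < ν → ∀ T : ℝ, 0 < T → ∀ (u₀ : ℝ³ → ℝ³)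
    (g : HomSobolev ℝ³ (EuclideanSpace ℂ (Fin 3)) (1 / 2 : ℝ)) (u : ℝ → ℝ³ → ℝ³),
    g.Represents (Literature.Analysis.FunctionSpaces.EuclideanSpace.complexify ∘ u₀) →
    IsKatoSolutionOn T ν u₀ u → (∀ t ∈ Ioo 0 T, IsAxisymmetric (u t)) →
    ∀ t ∈ Ioo 0 T, ∀ x : ℝ³, ‖u t x‖ ≤ F ν ‖g‖ t

end Summit.NavierStokesRegularity.NavierStokesRegularity.Cruxes.AxisymmetricKatoGlobal.StrategistS20g29

end
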